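import Summits.AtomisticToContinuum.FouriersLaw.Theorems.PhononMeanFreePathDefs
import Summits.AtomisticToContinuum.FouriersLaw.Theorems.PhononMeanFreePathCoherentDephasingStrictAbsorptionExpansion
import Summits.AtomisticToContinuum.FouriersLaw.Theorems.PhononMeanFreePathCoherentDephasingStrictAbsorptionLandauerWitness
import Summits.AtomisticToContinuum.FouriersLaw.Theorems.PhononMeanFreePathCoherentDephasingStrictAbsorptionReflect
import Summits.AtomisticToContinuum.FouriersLaw.Theorems.PhononMeanFreePathCoherentDephasingStrictAbsorptionVarianceFloor
import Summits.AtomisticToContinuum.FouriersLaw.Theorems.PhononMeanFreePathCoherentDephasingStrictAbsorptionUniform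
import Summits.AtomisticToContinuum.FouriersLaw.Theorems.PhononMeanFreePathCoherentDephasingStrictAbsorptionGeneratorCube
import Summits.AtomisticToContinuum.FouriersLaw.Theorems.PhononMeanFreePathCoherentDephasingWeakCouplingIntegrability
import Summits.AtomisticToContinuum.FouriersLaw.Theorems.PhononMeanFreePathCoherentDephasingTotalBalance
import Summits.AtomisticToContinuum.FouriersLaw.Theorems.PhononMeanFreePathCoherentDephasingMeanFieldDuhamel
import Summits.AtomisticToContinuum.FouriersLaw.Theorems.PhononMeanFreePathCoherentDephasingResponseRegularity

/-!
# STRICT ABSORPTION of the coherent kick, uniformly in the length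
# (line `Sketch`, crux `PhononMeanFreePath.CoherentDephasing`, stmt-AtomisticToContinuum-11810, lead c2)

For the `(N+1)`-site pinned anharmonic chain `pinnedChain ω₂ lam β γ` (all `> 0`) between two Langevin baths at `T > 0`,
let `m_x(t) = ⟨p₀, K_t p_x⟩_{μ_T}` be the Gibbs-averaged linear response of `p_x` to a unit kick on `p₀` (`× T`), so that
`r_N = m_N` is the crux's end-to-end response and, by the landed total balance of the coherent response field
(`totalBalance_of_meanField`), `T²/2 = γ(∫₀^∞ m_0² + ∫₀^∞ m_N²) + W_N` with `W_N` the work done on the mean anharmonic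
forces. **Theorem `strictAbsorption`** (registered stub):

  `∃ c > 0, ∀ N ≥ 2:  γ (∫₀^∞ m_0(t)² dt + ∫₀^∞ m_N(t)² dt) ≤ T²/2 - c`,

i.e. `W_N ≥ c` UNIFORMLY IN THE LENGTH: a fixed, `N`-independent amount of the kick's coherent energy is absorbed by
the anharmonic mean forces (for the harmonic chain `W_N = 0` for every `N` — the first rigorous `N`-uniform use of
anharmonicity on the coherent channel in the tree; it does not by itself give the `o(1/N)` rate the crux asks for).

Proof (which-path variance at the kicked site). With `u_s = K_s p₀`, Gaussian integration by parts gives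
`m_0(s) = T·E_μ[∂_{p₀}u_s]`, `m_N(s) = ⟨p_N, u_s⟩ = T·E_μ[∂_{p_N}u_s]` (reflection symmetry of the equilibrium kernels,
`sa_reflect`), and the Bakry–Émery dissipation inequality bounds `γT²∫(‖∂_{p₀}u_s‖² + ‖∂_{p_N}u_s‖²) ds ≤ T²/2`. The
slack of the Jensen step `(E ∂_{p₀}u_s)² ≤ ‖∂_{p₀}u_s‖²` is the VARIANCE of the averaged tangent response, and for
the centred local curvature `Φ̃ = Φ - ⟨Φ⟩`, `Φ = U''(q₀) + V''(q₁-q₀)`, `Var ≥ Cov(∂_{p₀}u_s, Φ)²/Var Φ` with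
`T·Cov(∂_{p₀}u_s, Φ) = ⟨p₀Φ̃, u_s⟩ =: A(s)` (no derivative needed) — `sa_landauerWitness`:
`Var(Φ)·γ(∫m_0²+∫m_N²) + γ∫A² ≤ Var(Φ)·T²/2`. Three Dynkin steps (`sa_witnessExpansion`: `sa_polyDynkin`,
`sa_generatorAlgebra`, `sa_generatorCube`, `sa_classBounds`, `sa_statics`) give `A(s) = -T·Var(Φ)·s²/2 + O(s³)` with an
`N`-uniform `O` (`sa_uniformCurvature`, `uniform_localPoly_sq`), and `Var_{μ_N}(Φ) ≥ v₀ > 0` uniformly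
(`sa_varianceFloor`, Cramér–Rao); hence `∫₀^{r₀} A² ≥ (Tv₀/4)² r₀⁵/5` with `r₀` independent of `N`, and the claim
follows with `c = γ (Tv₀/4)² r₀⁵/(5 C_V)`. No definition, no `sorry`, standard axioms.
-/

noncomputable section

open MeasureTheory ProbabilityTheory Filter Topology Set intervalIntegral
open scoped NNReal ENNReal

namespace Summit.AtomisticToContinuum.FouriersLaw.Theorems.CoherentDephasing.StrictAbsorption

open Literature.MathematicalPhysics.KineticTheory.HeatConduction
open Literature.MathematicalPhysics.KineticTheory Literature.Probability.Process OscillatorChain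
open Summit.AtomisticToContinuum.FouriersLaw.Theorems.PhononMeanFreePath
open Summit.AtomisticToContinuum.FouriersLaw.Theorems.CoherentDephasing.MeanFieldDuhamel (abs_snd_le)

/-- **The real-analysis core of strict absorption.** Abstractly: if three functions `m0, mN, A` on `(0,∞)` with
integrable squares satisfy the witnessed Landauer bound `∫ {V(m0² + mN'²) + A²} ≤ V T²/(2γ)` (lower integral; `mN' = mN`),
the witness has the short-time envelope `|A(t) + T V t²/2| ≤ M_N t³/6` with `M_N ≤ M`, and `0 < v₀ ≤ V ≤ C_V`, then
`γ(∫m0² + ∫mN²) ≤ T²/2 - γ (T v₀/4)² r₀⁵/(5 C_V)` with `r₀ = 3 T v₀/(2M)`. [folklore] -/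
theorem strict_abstract {γ T V v₀ CV M MN : ℝ} (hγ : 0 < γ) (hT : 0 < T) (hv₀ : 0 < v₀) (hVlo : v₀ ≤ V)
    (hVhi : V ≤ CV) (hM : 0 < M) (hMN : MN ≤ M) {m0 mN mN' A : ℝ → ℝ}
    (hI0 : IntegrableOn (fun t => m0 t ^ 2) (Ioi 0)) (hIN : IntegrableOn (fun t => mN t ^ 2) (Ioi 0))
    (hIA : IntegrableOn (fun t => A t ^ 2) (Ioi 0)) (hrefl : ∀ t, mN' t = mN t)
    (hK3 : ∫⁻ s in Ioi (0 : ℝ), ENNReal.ofReal (V * (m0 s ^ 2 + mN' s ^ 2) + A s ^ 2) ≤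
      ENNReal.ofReal (V * (T ^ 2 / (2 * γ))))
    (henv : ∀ t, 0 ≤ t → |A t + T * V * t ^ 2 / 2| ≤ MN * t ^ 3 / 6) :
    γ * ((∫ t in Ioi (0 : ℝ), m0 t ^ 2) + ∫ t in Ioi (0 : ℝ), mN t ^ 2) ≤
      T ^ 2 / 2 - γ * ((T * v₀ / 4) ^ 2 * (3 * T * v₀ / (2 * M)) ^ 5 / 5) / CV := by
  have hVpos : 0 < V := hv₀.trans_le hVlo
  have hCV : 0 < CV := hVpos.trans_le hVhi
  set r₀ : ℝ := 3 * T * v₀ / (2 * M) with hr₀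
  have hr₀0 : 0 < r₀ := by positivity
  have hrefl' : mN' = mN := funext hrefl
  rw [hrefl'] at hK3
  -- the envelope in one-sided form
  have henv' : ∀ t, 0 ≤ t → A t ≤ -(T * V) * t ^ 2 / 2 + M * t ^ 3 / 6 := by
    intro t ht
    have h1 := (abs_le.1 (henv t ht)).2
    have h2 : MN * t ^ 3 / 6 ≤ M * t ^ 3 / 6 := by
      have : 0 ≤ t ^ 3 / 6 := by positivity
      nlinarith
    linarith
  -- on `(0, r₀]` the witness is at least `(T v₀/4) t²` in size
  have hAlow : ∀ t, 0 < t → t ≤ r₀ → (T * v₀ / 4) ^ 2 * t ^ 4 ≤ A t ^ 2 := by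
    intro t ht htr
    have h1 := henv' t ht.le
    have h2 : M * t ^ 3 / 6 ≤ T * v₀ * t ^ 2 / 4 := by
      have : M * t ≤ M * r₀ := mul_le_mul_of_nonneg_left htr hM.le
      have e : M * r₀ = 3 * T * v₀ / 2 := by rw [hr₀]; field_simp
      nlinarith [sq_nonneg t]
    have h3 : T * v₀ * t ^ 2 / 4 ≤ T * V * t ^ 2 / 4 := by
      have := mul_le_mul_of_nonneg_left hVlo hT.le
      nlinarith [sq_nonneg t]
    have h4 : A t ≤ -(T * v₀ / 4 * t ^ 2) := by nlinarith
    have h5 : 0 ≤ T * v₀ / 4 * t ^ 2 := by positivity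
    have h6 : T * v₀ / 4 * t ^ 2 ≤ -A t := by linarith
    calc (T * v₀ / 4) ^ 2 * t ^ 4 = (T * v₀ / 4 * t ^ 2) ^ 2 := by ring
      _ ≤ (-A t) ^ 2 := pow_le_pow_left₀ h5 h6 2
      _ = A t ^ 2 := by ring
  -- from the lower integral to real integrals
  have hfi : IntegrableOn (fun s => V * (m0 s ^ 2 + mN s ^ 2) + A s ^ 2) (Ioi 0) :=
    ((hI0.add hIN).const_mul V).add hIA
  have hf0 : 0 ≤ᵐ[volume.restrict (Ioi (0 : ℝ))] fun s => V * (m0 s ^ 2 + mN s ^ 2) + A s ^ 2 :=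
    ae_of_all _ fun s => add_nonneg (mul_nonneg hVpos.le (add_nonneg (sq_nonneg _) (sq_nonneg _))) (sq_nonneg _)
  have hRHS0 : 0 ≤ V * (T ^ 2 / (2 * γ)) := mul_nonneg hVpos.le (by positivity)
  have hfint : ∫ s in Ioi (0 : ℝ), (V * (m0 s ^ 2 + mN s ^ 2) + A s ^ 2) ≤ V * (T ^ 2 / (2 * γ)) := by
    have e := integral_eq_lintegral_of_nonneg_ae hf0 hfi.aestronglyMeasurable
    have h := ENNReal.toReal_le_of_le_ofReal hRHS0 hK3
    rw [← e] at h
    exact h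
  have hsplit : ∫ s in Ioi (0 : ℝ), (V * (m0 s ^ 2 + mN s ^ 2) + A s ^ 2) =
      V * ((∫ s in Ioi (0 : ℝ), m0 s ^ 2) + ∫ s in Ioi (0 : ℝ), mN s ^ 2) + ∫ s in Ioi (0 : ℝ), A s ^ 2 := by
    have j0 : IntegrableOn (fun s => m0 s ^ 2 + mN s ^ 2) (Ioi 0) := hI0.add hIN
    have j1 : IntegrableOn (fun s => V * (m0 s ^ 2 + mN s ^ 2)) (Ioi 0) := j0.const_mul V
    have e1 : ∫ s in Ioi (0 : ℝ), (V * (m0 s ^ 2 + mN s ^ 2) + A s ^ 2) =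
        (∫ s in Ioi (0 : ℝ), V * (m0 s ^ 2 + mN s ^ 2)) + ∫ s in Ioi (0 : ℝ), A s ^ 2 := integral_add j1 hIA
    have e2 : ∫ s in Ioi (0 : ℝ), V * (m0 s ^ 2 + mN s ^ 2) = V * ∫ s in Ioi (0 : ℝ), (m0 s ^ 2 + mN s ^ 2) :=
      integral_const_mul _ _
    have e3 : ∫ s in Ioi (0 : ℝ), (m0 s ^ 2 + mN s ^ 2) =
        (∫ s in Ioi (0 : ℝ), m0 s ^ 2) + ∫ s in Ioi (0 : ℝ), mN s ^ 2 := integral_add hI0 hIN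
    rw [e1, e2, e3]
  -- the short-time lower bound on the witness term
  have hAint : (T * v₀ / 4) ^ 2 * r₀ ^ 5 / 5 ≤ ∫ s in Ioi (0 : ℝ), A s ^ 2 := by
    have hsub : ∫ s in Ioc (0 : ℝ) r₀, A s ^ 2 ≤ ∫ s in Ioi (0 : ℝ), A s ^ 2 :=
      setIntegral_mono_set hIA (ae_of_all _ fun s => sq_nonneg _) (ae_of_all _ Ioc_subset_Ioi_self)
    have hpoly : IntegrableOn (fun s : ℝ => (T * v₀ / 4) ^ 2 * s ^ 4) (Ioc 0 r₀) :=
      (by fun_prop : Continuous fun s : ℝ => (T * v₀ / 4) ^ 2 * s ^ 4).integrableOn_Ioc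
    have hmono : ∫ s in Ioc (0 : ℝ) r₀, (T * v₀ / 4) ^ 2 * s ^ 4 ≤ ∫ s in Ioc (0 : ℝ) r₀, A s ^ 2 :=
      setIntegral_mono_on hpoly (hIA.mono_set Ioc_subset_Ioi_self) measurableSet_Ioc
        fun s hs => hAlow s (Set.mem_Ioc.1 hs).1 (Set.mem_Ioc.1 hs).2
    have hval : ∫ s in Ioc (0 : ℝ) r₀, (T * v₀ / 4) ^ 2 * s ^ 4 = (T * v₀ / 4) ^ 2 * r₀ ^ 5 / 5 := by
      rw [← intervalIntegral.integral_of_le hr₀0.le, intervalIntegral.integral_const_mul, integral_pow]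
      norm_num; ring
    linarith
  -- conclusion
  set S : ℝ := (∫ s in Ioi (0 : ℝ), m0 s ^ 2) + ∫ s in Ioi (0 : ℝ), mN s ^ 2 with hS
  set X : ℝ := (T * v₀ / 4) ^ 2 * r₀ ^ 5 / 5 with hX
  have hX0 : 0 ≤ X := by
    rw [hX]; exact div_nonneg (mul_nonneg (sq_nonneg _) (pow_nonneg hr₀0.le 5)) (by norm_num)
  have hmain : V * S ≤ V * (T ^ 2 / (2 * γ)) - X := by rw [hsplit] at hfint; linarith
  have hdiv : S ≤ T ^ 2 / (2 * γ) - X / CV := by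
    have h1 : S ≤ (V * (T ^ 2 / (2 * γ)) - X) / V := by
      rw [le_div_iff₀ hVpos]; linarith [hmain]
    have e : (V * (T ^ 2 / (2 * γ)) - X) / V = T ^ 2 / (2 * γ) - X / V := by
      field_simp
    have h2 : X / CV ≤ X / V := div_le_div_of_nonneg_left hX0 hVpos hVhi
    linarith
  have h := mul_le_mul_of_nonneg_left hdiv hγ.le
  have e1 : γ * (T ^ 2 / (2 * γ)) = T ^ 2 / 2 := by field_simp
  have e2 : γ * (X / CV) = γ * X / CV := by ring
  rw [mul_sub, e1, e2] at h
  exact h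

/-- **STRICT ABSORPTION (registered stub `strictAbsorption`).** For every admissible parameter point there is
`c > 0` such that for every chain with `N ≥ 2`, `γ(∫₀^∞ m_0² + ∫₀^∞ m_N²) ≤ T²/2 - c`: the two baths together recapture at
most `T²/2 - c` of the kick's coherent energy `T²/2`, uniformly in the length. [folklore] -/
theorem strictAbsorption :
    ∀ ω₂ lam β γ : ℝ, 0 < ω₂ → 0 < lam → 0 < β → 0 < γ → ∀ T : ℝ, 0 < T → ∃ c : ℝ, 0 < c ∧ ∀ (N : ℕ) (hN : 2 ≤ N), γ * ((∫ t in Set.Ioi (0 : ℝ), momResp ω₂ lam β γ T N 0 t ^ 2) + ∫ t in Set.Ioi (0 : ℝ), momResp ω₂ lam β γ T N (Fin.last N) t ^ 2) ≤ T ^ 2 / 2 - c := by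
  intro ω₂ lam β γ hω hl hβ hγ T hT
  -- `N`-uniform constants
  obtain ⟨v₀, hv₀, hvar⟩ := sa_varianceFloor ω₂ lam β γ hω hl hβ hγ T hT
  obtain ⟨C₃, hcube⟩ := sa_generatorCube ω₂ lam β γ hω hl hβ hγ T hT
  obtain ⟨CV, hCV, huc⟩ := uniform_curvature_sq hω hl.le hβ hT
  obtain ⟨C₆, hC₆, hloc⟩ := uniform_localPoly_sq hω hl.le hβ hT
  set MG : ℝ := 2 * C₃ ^ 2 * (1 + 36 * C₆) with hMG
  have hMG0 : 0 ≤ MG := by positivity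
  set M : ℝ := (T * CV + MG) / 2 + 1 with hM
  have hM0 : 0 < M := by positivity
  set c : ℝ := γ * ((T * v₀ / 4) ^ 2 * (3 * T * v₀ / (2 * M)) ^ 5 / 5) / CV with hc
  have hc0 : 0 < c := by
    rw [hc]
    refine div_pos (mul_pos hγ ?_) hCV
    exact div_pos (mul_pos (pow_pos (by positivity) 2) (pow_pos (by positivity) 5)) (by norm_num)
  refine ⟨c, hc0, fun N hN => ?_⟩
  -- the chain of length `N + 1`
  have hNp : 0 < N + 1 := Nat.succ_pos N
  have hH0 : ∀ y, 0 ≤ (pinnedChain ω₂ lam β γ).hamiltonian (N + 1) y := fun y =>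
    pinnedChain_hamiltonian_nonneg hω.le hl.le hβ.le γ (N + 1) y
  obtain ⟨G₃, hG₃c, hgen₃, ⟨B₃, hB₃⟩, hG₃loc⟩ := hcube N hN
  -- sizes of the variance, of the weight `a = p₀Φ̃` and of `G₃`
  have hVlo := hvar N hN
  have hVhi := (huc N hN).2.2.2
  have ha2 := (sa_statics ω₂ lam β γ hω hl hβ hγ T hT N hN).2.2.2
  have hG3 : ∫ z, G₃ z ^ 2 ∂((pinnedChain ω₂ lam β γ).gibbsMeasure (N + 1) T) ≤ MG := (hloc N hN G₃ C₃ hG₃c hG₃loc).2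
  -- the which-path data from the landed sub-goals
  have hK3 := sa_landauerWitness ω₂ lam β γ hω hl hβ hγ T hT N hN
  have hrefl := fun t => (sa_reflect ω₂ lam β γ hω hl hβ hγ T hT N t).symm
  have henv := expansion_of_cube hω hl hβ hγ hT hN hG₃c hgen₃ hB₃
  -- integrability of the three squared correlations on `(0, ∞)`
  have hϑ0 : (0 : ℝ) < 1 / (4 * T) := by positivity
  have h2ϑ : 2 * (1 / (4 * T)) < 1 / T := by
    rw [show 2 * (1 / (4 * T)) = 1 / (2 * T) by field_simp; ring, div_lt_div_iff₀ (by positivity) hT]; nlinarith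
  have hp0 : ∫ y, (fun y : PhaseSpace (N + 1) => y.2 0) y ∂((pinnedChain ω₂ lam β γ).gibbsMeasure (N + 1) T) = 0 :=
    CoherentDephasing.pinnedChain_integral_momentum_gibbsMeasure (N + 1) T 0
  have hpL : ∫ y, (fun y : PhaseSpace (N + 1) => y.2 (Fin.last N)) y ∂((pinnedChain ω₂ lam β γ).gibbsMeasure (N + 1) T) = 0 :=
    CoherentDephasing.pinnedChain_integral_momentum_gibbsMeasure (N + 1) T (Fin.last N)
  have hwb : ∀ (i : Fin (N + 1)) (y : PhaseSpace (N + 1)), |y.2 i| ≤ (1 / 2 + 1 / (1 / (4 * T))) *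
      Real.exp (1 / (4 * T) * (pinnedChain ω₂ lam β γ).hamiltonian (N + 1) y) := fun i y =>
    CoherentDephasing.abs_momentum_le_exp hω.le hl.le hβ.le hϑ0 y i
  obtain ⟨K₂, hK₂⟩ : ∃ K, ∀ y, (1 + (pinnedChain ω₂ lam β γ).hamiltonian (N + 1) y) ^ 2 ≤
      K * Real.exp (1 / (4 * T) * (pinnedChain ω₂ lam β γ).hamiltonian (N + 1) y) :=
    ⟨_, fun y => LightConeBondHeat.one_add_pow_le_exp 2 (hH0 y) hϑ0⟩
  -- the weight `a = p₀ (Φ - Φ̄)` is continuous and of exponential size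
  set Φbar : ℝ := ∫ x, (ω₂ + 3 * lam * x.1 0 ^ 2 + 1 + 3 * β * (x.1 ⟨1, by omega⟩ - x.1 0) ^ 2) ∂((pinnedChain ω₂ lam β γ).gibbsMeasure (N + 1) T) with hΦbar
  set Ca : ℝ := (ω₂ + 1 + 6 * lam / ω₂ + 6 * β) + |Φbar| with hCa
  have hCa0 : 0 ≤ Ca := by rw [hCa]; positivity
  have hab : ∀ y : PhaseSpace (N + 1), |y.2 0 * ((ω₂ + 3 * lam * y.1 0 ^ 2 + 1 + 3 * β * (y.1 ⟨1, by omega⟩ - y.1 0) ^ 2) - Φbar)| ≤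
      (Ca * K₂) * Real.exp (1 / (4 * T) * (pinnedChain ω₂ lam β γ).hamiltonian (N + 1) y) := by
    intro y
    rw [abs_mul]
    obtain ⟨h0, h1⟩ := classBd_phi_bounds hω hl.le hβ.le γ hN y
    have hp : |y.2 0| ≤ 1 + (pinnedChain ω₂ lam β γ).hamiltonian (N + 1) y := abs_snd_le hl.le hβ.le γ hω.le y 0
    have hΦ' : |(ω₂ + 3 * lam * y.1 0 ^ 2 + 1 + 3 * β * (y.1 ⟨1, by omega⟩ - y.1 0) ^ 2) - Φbar| ≤ Ca * (1 + (pinnedChain ω₂ lam β γ).hamiltonian (N + 1) y) := by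
      calc |(ω₂ + 3 * lam * y.1 0 ^ 2 + 1 + 3 * β * (y.1 ⟨1, by omega⟩ - y.1 0) ^ 2) - Φbar| ≤ |(ω₂ + 3 * lam * y.1 0 ^ 2 + 1 + 3 * β * (y.1 ⟨1, by omega⟩ - y.1 0) ^ 2)| + |Φbar| := abs_sub _ _
        _ ≤ (ω₂ + 1 + 6 * lam / ω₂ + 6 * β) * (1 + (pinnedChain ω₂ lam β γ).hamiltonian (N + 1) y) +
            |Φbar| * (1 + (pinnedChain ω₂ lam β γ).hamiltonian (N + 1) y) := by
            rw [abs_of_nonneg h0]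
            refine add_le_add h1 ?_; nlinarith [abs_nonneg Φbar, hH0 y]
        _ = Ca * (1 + (pinnedChain ω₂ lam β γ).hamiltonian (N + 1) y) := by rw [hCa]; ring
    calc |y.2 0| * |(ω₂ + 3 * lam * y.1 0 ^ 2 + 1 + 3 * β * (y.1 ⟨1, by omega⟩ - y.1 0) ^ 2) - Φbar| ≤
        (1 + (pinnedChain ω₂ lam β γ).hamiltonian (N + 1) y) * (Ca * (1 + (pinnedChain ω₂ lam β γ).hamiltonian (N + 1) y)) :=
          mul_le_mul hp hΦ' (abs_nonneg _) (by linarith [hH0 y])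
      _ = Ca * (1 + (pinnedChain ω₂ lam β γ).hamiltonian (N + 1) y) ^ 2 := by ring
      _ ≤ Ca * (K₂ * Real.exp (1 / (4 * T) * (pinnedChain ω₂ lam β γ).hamiltonian (N + 1) y)) := mul_le_mul_of_nonneg_left (hK₂ y) hCa0
      _ = (Ca * K₂) * Real.exp (1 / (4 * T) * (pinnedChain ω₂ lam β γ).hamiltonian (N + 1) y) := by ring
  have hac : Continuous fun z : PhaseSpace (N + 1) => z.2 0 * ((ω₂ + 3 * lam * z.1 0 ^ 2 + 1 + 3 * β * (z.1 ⟨1, by omega⟩ - z.1 0) ^ 2) - Φbar) := by fun_prop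
  have hI0 := CoherentDephasing.pinnedChain_corr_sq_integrableOn hω hl.le hβ hγ hNp hT hϑ0 h2ϑ
      (a := fun z : PhaseSpace (N + 1) => z.2 0) (g := fun y : PhaseSpace (N + 1) => y.2 0)
      (by fun_prop) (by fun_prop) (hwb 0) (hwb 0) hp0
  have hIN := CoherentDephasing.pinnedChain_corr_sq_integrableOn hω hl.le hβ hγ hNp hT hϑ0 h2ϑ
      (a := fun z : PhaseSpace (N + 1) => z.2 0) (g := fun y : PhaseSpace (N + 1) => y.2 (Fin.last N))
      (by fun_prop) (by fun_prop) (hwb 0) (hwb (Fin.last N)) hpL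
  have hIA := CoherentDephasing.pinnedChain_corr_sq_integrableOn hω hl.le hβ hγ hNp hT hϑ0 h2ϑ
      (a := fun z : PhaseSpace (N + 1) => z.2 0 * ((ω₂ + 3 * lam * z.1 0 ^ 2 + 1 + 3 * β * (z.1 ⟨1, by omega⟩ - z.1 0) ^ 2) - Φbar)) (g := fun y : PhaseSpace (N + 1) => y.2 0)
      hac (by fun_prop) hab (hwb 0) hp0
  -- the abstract core
  have hMN : ((∫ z, (z.2 0 * ((ω₂ + 3 * lam * z.1 0 ^ 2 + 1 + 3 * β * (z.1 ⟨1, by omega⟩ - z.1 0) ^ 2) - Φbar)) ^ 2 ∂((pinnedChain ω₂ lam β γ).gibbsMeasure (N + 1) T)) +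
      ∫ z, G₃ z ^ 2 ∂((pinnedChain ω₂ lam β γ).gibbsMeasure (N + 1) T)) / 2 ≤ M := by
    have e : ∫ z, (z.2 0 * ((ω₂ + 3 * lam * z.1 0 ^ 2 + 1 + 3 * β * (z.1 ⟨1, by omega⟩ - z.1 0) ^ 2) - Φbar)) ^ 2 ∂((pinnedChain ω₂ lam β γ).gibbsMeasure (N + 1) T) =
        T * ∫ z, ((ω₂ + 3 * lam * z.1 0 ^ 2 + 1 + 3 * β * (z.1 ⟨1, by omega⟩ - z.1 0) ^ 2) - Φbar) ^ 2 ∂((pinnedChain ω₂ lam β γ).gibbsMeasure (N + 1) T) := ha2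
    rw [e, hM]
    nlinarith [mul_le_mul_of_nonneg_left hVhi hT.le]
  have key := strict_abstract (m0 := fun t => ∫ z, z.2 0 * (∫ y, y.2 0
        ∂((pinnedChain ω₂ lam β γ).transitionKernel (N + 1) T T t.toNNReal z)) ∂((pinnedChain ω₂ lam β γ).gibbsMeasure (N + 1) T))
      (mN := fun t => ∫ z, z.2 0 * (∫ y, y.2 (Fin.last N)
        ∂((pinnedChain ω₂ lam β γ).transitionKernel (N + 1) T T t.toNNReal z)) ∂((pinnedChain ω₂ lam β γ).gibbsMeasure (N + 1) T))
      (mN' := fun t => ∫ z, z.2 (Fin.last N) * (∫ y, y.2 0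
        ∂((pinnedChain ω₂ lam β γ).transitionKernel (N + 1) T T t.toNNReal z)) ∂((pinnedChain ω₂ lam β γ).gibbsMeasure (N + 1) T))
      (A := fun t => ∫ z, (z.2 0 * ((ω₂ + 3 * lam * z.1 0 ^ 2 + 1 + 3 * β * (z.1 ⟨1, by omega⟩ - z.1 0) ^ 2) - Φbar)) * (∫ y, y.2 0
        ∂((pinnedChain ω₂ lam β γ).transitionKernel (N + 1) T T t.toNNReal z)) ∂((pinnedChain ω₂ lam β γ).gibbsMeasure (N + 1) T))
      hγ hT hv₀ hVlo hVhi hM0 hMN hI0 hIN hIA hrefl hK3 henv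
  simpa only [momResp, kickResp, hc] using key

/-- **Strict absorption in work form: `W_N ≥ c` uniformly in the length.** With the landed total balance of the coherent
response field (`totalBalance_of_meanField`, fed with the landed Duhamel equations `stub_meanFieldDuhamel` and regularity
`stub_responseRegularity`), the total work done on the mean anharmonic forces
`W_N = lam Σ_x ∫₀^∞ m_x c_x + β Σ_b ∫₀^∞ d_b (m_{b+1} - m_b)` is at least `c > 0` for every `N ≥ 2`. [folklore] -/
theorem strictAbsorption_work :
    ∀ ω₂ lam β γ : ℝ, 0 < ω₂ → 0 < lam → 0 < β → 0 < γ → ∀ T : ℝ, 0 < T → ∃ c : ℝ, 0 < c ∧ ∀ (N : ℕ) (_ : 2 ≤ N),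
      c ≤ lam * (∑ x : Fin (N + 1), ∫ t in Set.Ioi (0 : ℝ), momResp ω₂ lam β γ T N x t * cubeResp ω₂ lam β γ T N x t) +
        β * ∑ b : Fin N, ∫ t in Set.Ioi (0 : ℝ), stretchCubeResp ω₂ lam β γ T N b t *
          (momResp ω₂ lam β γ T N b.succ t - momResp ω₂ lam β γ T N b.castSucc t) := by
  intro ω₂ lam β γ hω hl hβ hγ T hT
  obtain ⟨c, hc, h⟩ := strictAbsorption ω₂ lam β γ hω hl hβ hγ T hT
  refine ⟨c, hc, fun N hN => ?_⟩
  have hbal := TotalBalance.totalBalance_of_meanField ω₂ lam β γ hω hl hβ hγ T hT N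
    (MeanFieldDuhamel.stub_meanFieldDuhamel ω₂ lam β γ hω hl hβ hγ T hT N)
    (ResponseRegularity.stub_responseRegularity ω₂ lam β γ hω hl hβ hγ T hT N)
  have hN' := h N hN
  linarith

end Summit.AtomisticToContinuum.FouriersLaw.Theorems.CoherentDephasing.StrictAbsorption

end
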